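import Summits.BirchSwinnertonDyer.BirchSwinnertonDyer.Theorems.ManinLocalTwoThreeOddCongruenceNumberCurve
import Literature.NumberTheory.EllipticCurves.LocalReductionKrausMinimality
import Literature.NumberTheory.EllipticCurves.LFunctionPrimeCoeff
import Literature.NumberTheory.EllipticCurves.OrdinaryPrimesProofs
import Literature.NumberTheory.EllipticCurves.NewformsHeckeProofs
import HarnessLib

/-!
# E-imc-84 `IsolationCertificateForcesOddCongruence` HOLDS, via the schema `FamilyHeckeInputs` (refuter-1 RB66.4) —
# the blind tame family `E'_m : y² = x³ − 2m x² + p x`, `p = m² + 4`, at level `4p`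

Summit `BirchSwinnertonDyer`, route `ManinLocalTwoThree` (cell bsd-f2-manin), deciding crux C2 `ManinOddAtFour`
(stmt-BirchSwinnertonDyer-22967), the TAME TOTALLY-BLIND residual `RbTotallyBlindTame` (the `4(m² + 4)` family; MEMO-imc
§21, imc g15 idea `two-eisenstein-rank-one`).  Rows of record: `Rank1Residual/ManinAdditive/TwoEisensteinRankOneLaws.lean`
(typer g11, p625117): E-imc-84 `IsolationCertificateForcesOddCongruence := FourPFamilyIsolationCertified →
FourPFamilyCongruenceOdd` («THEOREM-candidate; inputs named») and the schema `FamilyHeckeInputs` («THEOREM-expected …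
what `IsNewformOf` plus the point-count formula must deliver in the tree»).  With p3's E-imc-90 assembly
`odd_congruenceNumber_of_twoAdicIsolationCertificate` (`Theorems/ManinLocalTwoThreeOddCongruenceNumberCurve.lean`,
p627462) the only missing input was the PARITY `2 ∣ a_ℓ(E'_m)`; this file supplies it:

* §1 `discOf_family` (`Δ(E'_m) = −256 p²`), `odd_p_of_family`, `not_pow_twelve_dvd`, **`isGloballyMinimal_family`**
  (`[0, −2m, 0, p, 0]` is a global minimal model: `q¹² ∤ Δ` for every prime `q`, tree `isGloballyMinimal_of_int_kraus`);
* §2 `two_dvd_natCard_point_of_a₄_ne_zero` (on `[0, a₂, 0, a₄, 0]` over a field with `a₄ ≠ 0`, `(0, 0)` is a point of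
  order `2`, so a finite point group has even order — Mathlib `Affine.Point.add_self_of_Y_eq`, `addOrderOf_dvd_natCard`)
  and **`two_dvd_lFunction_family`**: `2 ∣ a_ℓ(E'_m)` for every odd prime `ℓ ≠ p` (good reduction at `ℓ` since
  `ℓ ∤ Δ_min = −256p²`, tree `hasGoodReductionAtPrime_of_not_dvd`; `a_ℓ = ℓ + 1 − #Ẽ'_m(𝔽_ℓ)`, tree
  `LFunction_apply_prime_eq_frobeniusTrace`; the reduction is `[0, −2m, 0, p, 0] mod ℓ` with `p ≢ 0`);
* §3 **`FamilyHeckeInputs_holds : FamilyHeckeInputs`** (integrality `D.f_mem_integralCuspForms0`, `a₁ = 1`, the eigen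
  relation `IsNewform0.heckeT_eq_coeff_smul`, and the parity) and
  **`IsolationCertificateForcesOddCongruence_holds : IsolationCertificateForcesOddCongruence`** (E-imc-84 BY NAME).

Consequence for the cell's chain (MEMO-imc §21.9, refuter-1 §R58 RB66.5/66.7): the per-level DECIDABLE census law
E-imc-83 `FourPFamilyIsolationCertified` now implies Yazdani's expectation E-imc-82 `FourPFamilyCongruenceOdd` by a
THEOREM, hence (ARS Thm. 2.1 + ČNS Thm. 1.2, tree edges) odd optimal degree and `2 ∤ c` on the blind tame family.
No new definitions, no named fact, no sorry.  HONEST FRAMING: E-imc-83 / E-imc-85 remain LAWS (census 59/59, 7/7); nothing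
about BSD or Manin's conjecture is proved here; C2 remains open.

References: S. Yazdani, *Modular abelian varieties of odd modular degree* (2011), Thm. 3.8 and the paragraph after it
[cite: Yazdani2009, Thm. 3.8]; A. Agashe, K. Ribet, W. Stein (2012), §2.1, §3 [cite: AgasheRibetStein2012, §2.1];
J. H. Silverman, *AEC*, VII Remark 1.1, Exercise 8.19(a), §C.16 [cite: SilvermanAEC2009, Exercise 8.19(a) and §C.16].
-/

set_option linter.dupNamespace false

noncomputable section

open scoped MatrixGroups Classical

open CongruenceSubgroup WeierstrassCurve
  Literature.NumberTheory.EllipticCurves Literature.NumberTheory.EllipticCurves.ModularForms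
  Summit.BirchSwinnertonDyer.Rank1Residual.ManinAdditive.TwoEisenstein
open Literature.NumberTheory.EllipticCurves.Rank1Residual.X11RankOneCertificates (discOf c4Of c6Of invariants)

namespace Summit.BirchSwinnertonDyer.BirchSwinnertonDyer.Theorems.ManinLocalTwoThree

/-! ### §1. The family `E'_m : y² = x³ − 2m x² + p x`, `p = m² + 4` prime, `m ≡ 1 (mod 4)`: a global minimal model -/

section Family

variable (m : ℤ) (p : ℕ)

/-- `Δ(E'_m) = −256 p²` (with `p = m² + 4`). -/
theorem discOf_family (hp : (p : ℤ) = m ^ 2 + 4) :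
    discOf [0, -2 * m, 0, (p : ℤ), 0] = -256 * (p : ℤ) ^ 2 := by
  simp only [discOf, invariants]
  linear_combination (-64 * (p : ℤ) ^ 2) * hp

/-- `p = m² + 4` with `m ≡ 1 (mod 4)` is odd. -/
theorem odd_p_of_family (hm : m % 4 = 1) (hp : (p : ℤ) = m ^ 2 + 4) : Odd p := by
  obtain ⟨k, hk⟩ : ∃ k : ℤ, m = 4 * k + 1 := ⟨m / 4, by omega⟩
  have : (p : ℤ) = 2 * (8 * k ^ 2 + 4 * k + 2) + 1 := by
    linear_combination hp + (m + 4 * k + 1) * hk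
  rcases Int.even_or_odd (p : ℤ) with he | ho
  · exfalso
    obtain ⟨t, ht⟩ := he
    omega
  · exact_mod_cast (Int.odd_coe_nat p).mp ho

/-- For a prime `q` and an odd prime `p`, `q¹² ∤ 256 p²`. -/
theorem not_pow_twelve_dvd (hpr : p.Prime) (hodd : Odd p) {q : ℕ} (hq : q.Prime) :
    ¬ (q : ℤ) ^ 12 ∣ -256 * (p : ℤ) ^ 2 := by
  intro h
  have h' : q ^ 12 ∣ 256 * p ^ 2 := by
    have := (Int.dvd_neg.mpr h)
    rw [show -(-256 * (p : ℤ) ^ 2) = ((256 * p ^ 2 : ℕ) : ℤ) by push_cast; ring] at this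
    exact_mod_cast this
  rcases eq_or_ne q 2 with rfl | hq2
  · have h16 : 2 ^ 4 ∣ p ^ 2 := by
      have : 2 ^ 8 * 2 ^ 4 ∣ 2 ^ 8 * p ^ 2 := by simpa [show (256 : ℕ) = 2 ^ 8 by norm_num, ← pow_add] using h'
      exact Nat.dvd_of_mul_dvd_mul_left (by norm_num) this
    have h2p : 2 ∣ p := Nat.prime_two.dvd_of_dvd_pow (dvd_trans ⟨2 ^ 3, by norm_num⟩ h16)
    exact hodd.not_two_dvd_nat h2p
  · have hcop : Nat.Coprime (q ^ 12) 256 := by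
      rw [show (256 : ℕ) = 2 ^ 8 by norm_num]
      exact Nat.Coprime.pow _ _ ((Nat.coprime_primes hq Nat.prime_two).mpr hq2)
    have hqp : q ^ 12 ∣ p ^ 2 := hcop.dvd_of_dvd_mul_left h'
    have hq_dvd_p : q ∣ p := hq.dvd_of_dvd_pow (dvd_trans (dvd_pow_self q (by norm_num)) hqp)
    have hqp' : q = p := (Nat.prime_dvd_prime_iff_eq hq hpr).mp hq_dvd_p
    subst hqp'
    have : q ^ 12 ≤ q ^ 2 := Nat.le_of_dvd (pow_pos hq.pos 2) hqp
    have : q ^ 2 < q ^ 12 := Nat.pow_lt_pow_right hq.one_lt (by norm_num)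
    omega

/-- **`E'_m = [0, −2m, 0, p, 0]` is a global minimal model** (`Δ = −256 p²`, `q¹² ∤ Δ` for every prime `q`;
Silverman VII Remark 1.1 via the tree's `isGloballyMinimal_of_int_kraus`). -/
theorem isGloballyMinimal_family (hm : m % 4 = 1) (hp : (p : ℤ) = m ^ 2 + 4) (hpr : p.Prime) :
    (⟨((0 : ℤ) : ℚ), ((-2 * m : ℤ) : ℚ), ((0 : ℤ) : ℚ), ((p : ℤ) : ℚ), ((0 : ℤ) : ℚ)⟩ :
      WeierstrassCurve ℚ).IsGloballyMinimal := by
  refine isGloballyMinimal_of_int_kraus 0 (-2 * m) 0 (p : ℤ) 0 fun q hq ↦ Or.inl ?_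
  rintro ⟨h12, -⟩
  rw [discOf_family m p hp] at h12
  exact not_pow_twelve_dvd p hpr (odd_p_of_family m p hm hp) hq h12

/-- The family curve in the typed form `⟨0, −2m, 0, p, 0⟩` equals the integer-cast model. -/
theorem family_eq_intModel :
    (⟨0, -2 * (m : ℚ), 0, (p : ℚ), 0⟩ : WeierstrassCurve ℚ) =
      ⟨((0 : ℤ) : ℚ), ((-2 * m : ℤ) : ℚ), ((0 : ℤ) : ℚ), ((p : ℤ) : ℚ), ((0 : ℤ) : ℚ)⟩ := by
  ext <;> push_cast <;> rfl

end Family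

/-! ### §2. Parity: `a_ℓ(E'_m)` is even at every odd prime `ℓ ≠ p` (the rational `2`-torsion point `(0,0)`) -/

section Parity

/-- On a curve `[0, a₂, 0, a₄, 0]` over a field with `a₄ ≠ 0`, the point `(0, 0)` is a non-zero `2`-torsion point, so
the group of points, when finite, has even order. -/
theorem two_dvd_natCard_point_of_a₄_ne_zero {F : Type*} [Field F] [DecidableEq F] (V : WeierstrassCurve F)
    (h1 : V.a₁ = 0) (h3 : V.a₃ = 0) (h6 : V.a₆ = 0) (h4 : V.a₄ ≠ 0) [Finite V.toAffine.Point] :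
    2 ∣ Nat.card V.toAffine.Point := by
  have hns : V.toAffine.Nonsingular 0 0 := by
    rw [WeierstrassCurve.Affine.nonsingular_iff']
    refine ⟨?_, Or.inl ?_⟩
    · rw [WeierstrassCurve.Affine.equation_iff]
      simp [h3, h6]
    · simpa [h1] using h4
  set P : V.toAffine.Point := WeierstrassCurve.Affine.Point.some _ _ hns with hP
  have hP0 : P ≠ 0 := WeierstrassCurve.Affine.Point.some_ne_zero hns
  have h2P : P + P = 0 := by
    refine WeierstrassCurve.Affine.Point.add_self_of_Y_eq ?_
    simp [WeierstrassCurve.Affine.negY, h1, h3]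
  have hord : addOrderOf P = 2 := by
    rw [addOrderOf_eq_prime_iff]
    exact ⟨by rwa [two_nsmul], hP0⟩
  rw [← hord]
  exact addOrderOf_dvd_natCard P

variable (m : ℤ) (p : ℕ)

/-- **`a_ℓ(E'_m)` is even** for every odd prime `ℓ ≠ p` (good reduction; `#Ẽ'_m(𝔽_ℓ)` is even because `(0,0)` is a
rational point of order `2`; `a_ℓ = ℓ + 1 − #Ẽ'_m(𝔽_ℓ)`, tree `LFunction_apply_prime_eq_frobeniusTrace`).
[cite: SilvermanAEC2009, Exercise 8.19(a) and §C.16] -/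
theorem two_dvd_lFunction_family (hm : m % 4 = 1) (hp : (p : ℤ) = m ^ 2 + 4) (hpr : p.Prime)
    {ℓ : ℕ} (hℓ : ℓ.Prime) (hℓodd : Odd ℓ) (hℓp : ℓ ≠ p) :
    (2 : ℤ) ∣ (⟨0, -2 * (m : ℚ), 0, (p : ℚ), 0⟩ : WeierstrassCurve ℚ).LFunction ℓ := by
  rw [family_eq_intModel m p]
  haveI := isGloballyMinimal_family m p hm hp hpr
  haveI : Fact ℓ.Prime := ⟨hℓ⟩
  set W : WeierstrassCurve ℚ := ⟨((0 : ℤ) : ℚ), ((-2 * m : ℤ) : ℚ), ((0 : ℤ) : ℚ), ((p : ℤ) : ℚ), ((0 : ℤ) : ℚ)⟩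
    with hW
  -- the integral model is `[0, −2m, 0, p, 0]`
  have hM : integralModelInt W = ⟨0, -2 * m, 0, (p : ℤ), 0⟩ := by
    apply WeierstrassCurve.map_injective (RingHom.injective_int (Int.castRingHom ℚ))
    show (integralModelInt W).map (Int.castRingHom ℚ) =
      (⟨0, -2 * m, 0, (p : ℤ), 0⟩ : WeierstrassCurve ℤ).map (Int.castRingHom ℚ)
    rw [map_integralModelInt]
    ext <;> simp [hW]
  have hΔ : minimalDiscriminantInt W = -256 * (p : ℤ) ^ 2 := by
    rw [minimalDiscriminantInt, hM]
    simp only [WeierstrassCurve.Δ, WeierstrassCurve.b₂, WeierstrassCurve.b₄, WeierstrassCurve.b₆,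
      WeierstrassCurve.b₈]
    linear_combination (-64 * (p : ℤ) ^ 2) * hp
  have hodd := odd_p_of_family m p hm hp
  -- good reduction at `ℓ`
  have hgood : W.HasGoodReductionAtPrime ℓ := by
    refine hasGoodReductionAtPrime_of_not_dvd W ℓ ?_
    rw [hΔ]
    intro h
    have h' : (ℓ : ℤ) ∣ 256 * (p : ℤ) ^ 2 := by
      have := Int.dvd_neg.mpr h; rwa [show -(-256 * (p : ℤ) ^ 2) = 256 * (p : ℤ) ^ 2 by ring] at this
    have h'' : ℓ ∣ 256 * p ^ 2 := by exact_mod_cast h'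
    rcases (Nat.Prime.dvd_mul hℓ).mp h'' with h256 | hp2
    · have : ℓ ∣ 2 := by
        rw [show (256 : ℕ) = 2 ^ 8 by norm_num] at h256
        exact hℓ.dvd_of_dvd_pow h256
      have : ℓ = 2 := (Nat.prime_dvd_prime_iff_eq hℓ Nat.prime_two).mp this
      exact hℓodd.not_two_dvd_nat (this ▸ dvd_rfl)
    · exact hℓp ((Nat.prime_dvd_prime_iff_eq hℓ hpr).mp (hℓ.dvd_of_dvd_pow hp2))
  haveI : W.IsElliptic := by
    refine ⟨?_⟩
    rw [hW, (Δ_c₄_c₆_eq_intCast 0 (-2 * m) 0 (p : ℤ) 0).1, discOf_family m p hp]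
    have : (p : ℚ) ≠ 0 := by exact_mod_cast hpr.ne_zero
    exact isUnit_iff_ne_zero.mpr (by push_cast; positivity)
  rw [LFunction_apply_prime_eq_frobeniusTrace W ℓ hgood, frobeniusTrace, reductionPointCount, hM]
  -- the reduction `[0, −2m, 0, p, 0] mod ℓ` has the `2`-torsion point `(0, 0)`
  have hp0 : ((p : ℤ) : ZMod ℓ) ≠ 0 := by
    rw [Int.cast_natCast, Ne, ZMod.natCast_eq_zero_iff]
    exact fun h ↦ hℓp ((Nat.prime_dvd_prime_iff_eq hℓ hpr).mp h)
  haveI : Finite ((⟨0, -2 * m, 0, (p : ℤ), 0⟩ : WeierstrassCurve ℤ).map (Int.castRingHom (ZMod ℓ))).toAffine.Point := by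
    rw [← hM]; exact finite_point_reduction W ℓ
  have h2 := two_dvd_natCard_point_of_a₄_ne_zero
    (((⟨0, -2 * m, 0, (p : ℤ), 0⟩ : WeierstrassCurve ℤ).map (Int.castRingHom (ZMod ℓ))))
    (by simp) (by simp) (by simp) (by simpa using hp0)
  obtain ⟨c, hc⟩ := h2
  obtain ⟨l, hl⟩ := hℓodd
  refine ⟨(l : ℤ) + 1 - c, ?_⟩
  rw [hc, hl]; push_cast; ring

end Parity

/-! ### §3. The schema `FamilyHeckeInputs` and E-imc-84 `IsolationCertificateForcesOddCongruence` hold -/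

section Holds

/-- **`FamilyHeckeInputs` holds** (refuter-1 §R58 RB66.4's THEOREM-expected schema): for the family datum `D` at level
`4p` and an odd prime `ℓ ≠ p` with `a = a_ℓ(D.f)`: `D.f ∈ S₂(ℤ)`, `a₁(D.f) = 1`, `T_ℓ D.f = a • D.f` (newform:
tree `IsNewform0.heckeT_eq_coeff_smul`) and `2 ∣ a` (`a = a_ℓ(E'_m)` is even: rational `2`-torsion). -/
theorem FamilyHeckeInputs_holds : FamilyHeckeInputs := by
  intro m p _ D ℓ hℓ a hm hp hpr hℓodd hℓp ha
  haveI : NeZero ℓ := ⟨hℓ.ne_zero⟩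
  obtain ⟨-, -, hf1⟩ := D.isNewformOf.1
  refine ⟨D.f_mem_integralCuspForms0, hf1, ?_, ?_⟩
  · rw [D.isNewformOf.1.heckeT_eq_coeff_smul hℓ]
    congr 1
    exact ha.symm
  · have h2 := two_dvd_lFunction_family m p hm hp hpr hℓ hℓodd hℓp
    have hcoef : (a : ℂ) = ((WeierstrassCurve.LFunction
        (⟨0, -2 * (m : ℚ), 0, (p : ℚ), 0⟩ : WeierstrassCurve ℚ) ℓ : ℤ) : ℂ) := by
      rw [ha, D.isNewformOf.2 ℓ]
    have : a = (⟨0, -2 * (m : ℚ), 0, (p : ℚ), 0⟩ : WeierstrassCurve ℚ).LFunction ℓ := by exact_mod_cast hcoef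
    rwa [this]

/-- **E-imc-84 `IsolationCertificateForcesOddCongruence` holds**: a `2`-adic isolation certificate at one odd prime
`ℓ ≠ p` forces the congruence number of the family newform to be odd — E-imc-90 (p3's
`odd_congruenceNumber_of_twoAdicIsolationCertificate`, p627462) fed with `FamilyHeckeInputs_holds`.  Hence the census
law E-imc-83 `FourPFamilyIsolationCertified` (decidable per level) implies Yazdani's expectation E-imc-82
`FourPFamilyCongruenceOdd` by a THEOREM.  Nothing about BSD or Manin's conjecture is proved here. -/
theorem IsolationCertificateForcesOddCongruence_holds : IsolationCertificateForcesOddCongruence := by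
  intro h83 m p _ D hm hp hpr
  obtain ⟨ℓ, hℓ, a, hℓodd, hℓp, ha, hcert⟩ := h83 m p D hm hp hpr
  haveI : NeZero ℓ := ⟨hℓ.ne_zero⟩
  obtain ⟨-, -, hT, h2a⟩ := FamilyHeckeInputs_holds m p D ℓ hℓ a hm hp hpr hℓodd hℓp ha
  have hℓN : ¬ ℓ ∣ 4 * p := by
    intro h
    rcases (Nat.Prime.dvd_mul hℓ).mp h with h4 | hpp
    · have : ℓ ∣ 2 := by
        rw [show (4 : ℕ) = 2 ^ 2 by norm_num] at h4; exact hℓ.dvd_of_dvd_pow h4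
      have : ℓ = 2 := (Nat.prime_dvd_prime_iff_eq hℓ Nat.prime_two).mp this
      exact hℓodd.not_two_dvd_nat (this ▸ dvd_rfl)
    · exact hℓp ((Nat.prime_dvd_prime_iff_eq hℓ hpr).mp hpp)
  exact odd_congruenceNumber_of_twoAdicIsolationCertificate D hℓ hℓodd hℓN hT h2a hcert

end Holds

end Summit.BirchSwinnertonDyer.BirchSwinnertonDyer.Theorems.ManinLocalTwoThree

end
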